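import Literature.Computability.QuantumComplexity.HaarUnitaryHidingDensity
import HarnessLib

/-!
# Discharge of the Haar-Unitary Hiding Theorem (Aaronson–Arkhipov 2013, Thm. 5.2)

The named fact `haarUnitaryHiding` of `HaarUnitaryHiding.lean` — S. Aaronson, A. Arkhipov,
*The computational complexity of linear optics*, Theory of Computing 9 (2013) 143–252, Thm. 5.2
(Haar-Unitary Hiding Theorem, p. 183), measure form: there are `C, δ₀ > 0` such that for `n ≥ 1`,
`0 < δ ≤ δ₀`, `m ≥ (n⁵/δ) ln²(n/δ)` and every measurable `E ⊆ ℂ^{n×n}`,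
`𝒮_{m,n}(E) ≤ (1 + Cδ) 𝒢^{n×n}(E)` — is proved by combining the two halves already in the tree:

* `haarUnitaryHiding_of_truncatedHaarDensity` (`HaarUnitaryHidingProofs.lean`): AA13's argument
  (pp. 184–190, with `C = 150`, `δ₀ = 1/200`) from Réffy's density of the truncated Haar unitary,
  eq. (5.5);
* `truncatedHaarDensity_holds` (`HaarUnitaryHidingDensity.lean`): that density, from the law of
  the corner of a Haar unitary (Collins 2005, Thm. 5.1, `HaarCornerDensity.lean`).

## References

* S. Aaronson, A. Arkhipov, *The computational complexity of linear optics*, Theory of Computing 9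
  (2013) 143–252, §5.1, Thm. 5.2.
-/

namespace Literature.Computability.QuantumComplexity

/-- **The Haar-Unitary Hiding Theorem (Aaronson–Arkhipov 2013, Thm. 5.2), discharged**: the named
fact `haarUnitaryHiding` holds — AA13's proof (`haarUnitaryHiding_of_truncatedHaarDensity`) fed with
Réffy's density formula (`truncatedHaarDensity_holds`).
[cite: AaronsonArkhipovToC2013, Thm. 5.2 (p. 183)] -/
theorem haarUnitaryHiding_holds : haarUnitaryHiding :=
  haarUnitaryHiding_of_truncatedHaarDensity truncatedHaarDensity_holds

end Literature.Computability.QuantumComplexity
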